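import Literature.MathematicalPhysics.KineticTheory.HardSphereEulerProofs
import Literature.Barriers.AtomisticToContinuum.HighMomentumCutoff
import HarnessLib

/-!
# `LambertianEuler` (stmt-AtomisticToContinuum-11854), line `Sketch`, stub `stub_tailsLambda`:
# the rung `s = t = 0` — Gaussian velocity moments of the local Gibbs laws

Registered sub-goal `localGibbs_expVelocityMoment_le` of the research-grade stub
`stub_tailsLambda` (`TailsLambda`: `N`-uniform Gaussian velocity moments IN EXPECTATION along the
Lambertian hard-sphere flow, pre-shock) of the skeleton
`Cruxes/LambertianEuler/Lines/Sketch.lean`: at time zero the Lambertian flow is the identity and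
`TailsLambda` reduces to a STATIC statement about the local Gibbs laws
`λ_N = localGibbsLaw σ a₀ u₀ θ₀ N Φ` — for continuous profiles `a₀, θ₀ > 0`, `u₀` and `σ ≤ 1/2`
there are `a > 0` and `C < ∞` with

  `∫ (N+1)⁻¹ ∑ᵢ exp(a ‖vᵢ‖²) dλ_N ≤ C` for every `N` and every flow `Φ`

(`Literature.Barriers.AtomisticToContinuum.expVelocityMoment a`, the observable of
Nachtergaele–Yau's high-momentum assumption II.1).

## Proof

Given the positions, the local Gibbs velocities are independent Gaussians
`N(u₀(xᵢ), θ₀(xᵢ) id)` (disintegration `lintegral_localGibbsMeasure`; the position marginal has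
mass one for `σ ≤ 1/2`, `lintegral_posWeight_eq_one`).  Fernique's theorem
(`ProbabilityTheory.IsGaussian.exists_integrable_exp_sq`) gives `c > 0` with
`I_c = ∫ e^{c‖w‖²} dN(0, id) < ∞` on `ℝ³`; with `Θ = max θ₀`, `U ≥ ‖u₀‖` (compact torus) and
`a = c / (2Θ)` the affine transfer `v = u + √θ w`, `‖u + √θ w‖² ≤ 2‖u‖² + 2θ‖w‖²`, gives the
one-body bound `∫ e^{a‖v‖²} dN(u, θ id) ≤ K = e^{2aU²} I_c` uniformly in `x`, whence
`E_{λ_N} e^{a‖vᵢ‖²} ≤ K` for every particle and, averaging over `i`, `E_{λ_N} (N+1)⁻¹∑ᵢ e^{a‖vᵢ‖²} ≤ K`.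

The one-body transfer and the disintegration step are adapted from
`Theorems/OneFlightGossipEngineEnergyCurrentTailsLevelCensusStatics.lean` (namespace
`…Theorems.EnergyCurrentTailsLevelCensus`), re-proved here to keep the file on `Literature` imports.

References: H. Spohn, *Large Scale Dynamics of Interacting Particles* (1991), Part I §2.3;
X. Fernique, C. R. Acad. Sci. Paris 270 (1970); B. Nachtergaele, H.-T. Yau, Comm. Math. Phys. 243
(2003), §2.3 Assumption II.1.
-/

noncomputable section

open scoped BigOperators Topology ENNReal InnerProductSpace
open MeasureTheory ProbabilityTheory Filter Set
open Literature.MathematicalPhysics.KineticTheory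
open Literature.Analysis.FluidPDE

namespace Summit.AtomisticToContinuum.HydrodynamicLimit.Theorems.LambertianContactSwapLambertianEulerTailsZero

/-! ## One-body Gaussian exponential moments -/

-- transfer argument adapted from Theorems/OneFlightGossipEngineEnergyCurrentTailsLevelCensusStatics.lean
/-- **Uniform one-body Gaussian exponential moment (Fernique + compactness of `𝕋³`).**  For
continuous `θ₀ > 0` and `u₀` there are `a > 0` and `K` with
`∫ e^{a‖v‖²} dN(u₀(x), θ₀(x) id) ≤ K` for every `x ∈ 𝕋³`: Fernique's theorem
(`IsGaussian.exists_integrable_exp_sq`) gives `c > 0` with `e^{c‖w‖²}` integrable for the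
standard Gaussian on `ℝ³`; with `a = c/(2 max θ₀)` and `U ≥ ‖u₀‖`, the transfer
`gaussMeasure u θ = (w ↦ u + √θ w)_* N(0, id)` and `‖u + √θ w‖² ≤ 2‖u‖² + 2θ‖w‖²` give
`∫ e^{a‖v‖²} dN(u, θ id) ≤ K = e^{2aU²} ∫ e^{c‖w‖²} dN(0, id)`. [folklore] -/
theorem tailsZero_exists_lintegral_exp_gaussMeasure_le {θ₀ : T3 → ℝ} {u₀ : T3 → V3}
    (hθ : Continuous θ₀) (hu : Continuous u₀) (hθ0 : ∀ x, 0 < θ₀ x) :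
    ∃ a : ℝ, 0 < a ∧ ∃ K : ℝ, ∀ x : T3,
      ∫⁻ v, ENNReal.ofReal (Real.exp (a * ‖v‖ ^ 2)) ∂gaussMeasure (u₀ x) (θ₀ x) ≤
        ENNReal.ofReal K := by
  -- Fernique for the standard Gaussian on `ℝ³`
  obtain ⟨c, hc, hint⟩ := IsGaussian.exists_integrable_exp_sq (stdGaussian V3)
  -- extrema of the continuous profiles on the compact torus
  obtain ⟨xM, -, hxM⟩ := isCompact_univ.exists_isMaxOn univ_nonempty hθ.continuousOn
  obtain ⟨U, hU⟩ : ∃ U : ℝ, ∀ x, ‖u₀ x‖ ≤ U := by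
    obtain ⟨B, hB⟩ := isCompact_univ.exists_bound_of_continuousOn hu.continuousOn
    exact ⟨B, fun x => hB x (mem_univ x)⟩
  have hmax : ∀ y, θ₀ y ≤ θ₀ xM := fun y => hxM (mem_univ y)
  have hθM : 0 < θ₀ xM := hθ0 xM
  set a : ℝ := c / (2 * θ₀ xM) with ha_def
  have ha : 0 < a := div_pos hc (by positivity)
  refine ⟨a, ha, Real.exp (2 * a * U ^ 2) * ∫ w, Real.exp (c * ‖w‖ ^ 2) ∂stdGaussian V3,
    fun x => ?_⟩
  -- the one-body transfer at `u = u₀ x`, `θ = θ₀ x`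
  have haθ : 2 * a * θ₀ x ≤ c :=
    calc 2 * a * θ₀ x ≤ 2 * a * θ₀ xM := mul_le_mul_of_nonneg_left (hmax x) (by positivity)
      _ = c := by rw [ha_def]; field_simp
  have hm : Measurable fun v : V3 => ENNReal.ofReal (Real.exp (a * ‖v‖ ^ 2)) :=
    (Real.measurable_exp.comp ((measurable_norm.pow_const 2).const_mul a)).ennreal_ofReal
  have hmc : Measurable fun w : V3 => ENNReal.ofReal (Real.exp (c * ‖w‖ ^ 2)) :=
    (Real.measurable_exp.comp ((measurable_norm.pow_const 2).const_mul c)).ennreal_ofReal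
  have hU2 : ‖u₀ x‖ ^ 2 ≤ U ^ 2 := pow_le_pow_left₀ (norm_nonneg _) (hU x) 2
  -- `‖u + √θ w‖² ≤ 2‖u‖² + 2θ‖w‖²`
  have hsq : ∀ w : V3, ‖u₀ x + Real.sqrt (θ₀ x) • w‖ ^ 2 ≤
      2 * ‖u₀ x‖ ^ 2 + 2 * θ₀ x * ‖w‖ ^ 2 := by
    intro w
    have h1 : ‖u₀ x + Real.sqrt (θ₀ x) • w‖ ≤ ‖u₀ x‖ + Real.sqrt (θ₀ x) * ‖w‖ := by
      calc ‖u₀ x + Real.sqrt (θ₀ x) • w‖ ≤ ‖u₀ x‖ + ‖Real.sqrt (θ₀ x) • w‖ := norm_add_le _ _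
        _ = ‖u₀ x‖ + Real.sqrt (θ₀ x) * ‖w‖ := by
            rw [norm_smul, Real.norm_of_nonneg (Real.sqrt_nonneg _)]
    have h2 : Real.sqrt (θ₀ x) ^ 2 = θ₀ x := Real.sq_sqrt (hθ0 x).le
    calc ‖u₀ x + Real.sqrt (θ₀ x) • w‖ ^ 2 ≤ (‖u₀ x‖ + Real.sqrt (θ₀ x) * ‖w‖) ^ 2 :=
          pow_le_pow_left₀ (norm_nonneg _) h1 2
      _ ≤ 2 * ‖u₀ x‖ ^ 2 + 2 * (Real.sqrt (θ₀ x) * ‖w‖) ^ 2 := by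
          nlinarith [sq_nonneg (‖u₀ x‖ - Real.sqrt (θ₀ x) * ‖w‖)]
      _ = 2 * ‖u₀ x‖ ^ 2 + 2 * θ₀ x * ‖w‖ ^ 2 := by rw [mul_pow, h2]; ring
  rw [gaussMeasure, lintegral_map hm (measurable_gaussShift (u₀ x) (θ₀ x))]
  calc ∫⁻ w, ENNReal.ofReal (Real.exp (a * ‖u₀ x + Real.sqrt (θ₀ x) • w‖ ^ 2)) ∂stdGaussian V3
      ≤ ∫⁻ w, ENNReal.ofReal (Real.exp (2 * a * U ^ 2)) *
          ENNReal.ofReal (Real.exp (c * ‖w‖ ^ 2)) ∂stdGaussian V3 := by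
        refine lintegral_mono fun w => ?_
        rw [← ENNReal.ofReal_mul (Real.exp_pos _).le, ← Real.exp_add]
        refine ENNReal.ofReal_le_ofReal (Real.exp_le_exp.2 ?_)
        have h1 : a * ‖u₀ x + Real.sqrt (θ₀ x) • w‖ ^ 2 ≤
            a * (2 * ‖u₀ x‖ ^ 2 + 2 * θ₀ x * ‖w‖ ^ 2) :=
          mul_le_mul_of_nonneg_left (hsq w) ha.le
        have h2 : 2 * a * θ₀ x * ‖w‖ ^ 2 ≤ c * ‖w‖ ^ 2 :=
          mul_le_mul_of_nonneg_right haθ (sq_nonneg _)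
        nlinarith
    _ = ENNReal.ofReal (Real.exp (2 * a * U ^ 2)) *
          ∫⁻ w, ENNReal.ofReal (Real.exp (c * ‖w‖ ^ 2)) ∂stdGaussian V3 :=
        lintegral_const_mul _ hmc
    _ = _ := by
        rw [← ofReal_integral_eq_lintegral_ofReal hint (ae_of_all _ fun w => (Real.exp_pos _).le),
          ← ENNReal.ofReal_mul (Real.exp_pos _).le]

/-! ## Exponential velocity moments under the local Gibbs law -/

-- adapted from Theorems/OneFlightGossipEngineEnergyCurrentTailsLevelCensusStatics.lean
/-- **Per-particle exponential moment under the local Gibbs law.**  If the one-body bound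
`∫ e^{a‖v‖²} dN(u₀(x), θ₀(x) id) ≤ K` holds uniformly in `x ∈ 𝕋³`, then for `σ ≤ 1/2`, every `N`,
every flow `Φ` and every particle `i`: `E_{λ_N} e^{a‖vᵢ‖²} ≤ K` — disintegrate `λ_N` into
positions and independent Gaussian velocities (`lintegral_localGibbsMeasure`; the position
marginal has mass one, `lintegral_posWeight_eq_one`) and evaluate the `i`-th Gaussian factor
(`measurePreserving_eval`). [folklore] -/
theorem tailsZero_lintegral_exp_localGibbsLaw_le {a₀ θ₀ : T3 → ℝ} {u₀ : T3 → V3}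
    (ha : Continuous a₀) (hθ : Continuous θ₀) (hu : Continuous u₀)
    (ha0 : ∀ x, 0 < a₀ x) (hθ0 : ∀ x, 0 < θ₀ x) {a : ℝ} {K : ℝ≥0∞}
    (hK : ∀ x : T3, ∫⁻ v, ENNReal.ofReal (Real.exp (a * ‖v‖ ^ 2)) ∂gaussMeasure (u₀ x) (θ₀ x) ≤ K)
    {σ : ℝ} (hσ2 : σ ≤ 1 / 2) (N : ℕ)
    (Φ : HardSphereFlow (Torus.geometry (Fin 3)) (hsDiameter σ N) (N + 1)) (i : Fin (N + 1)) :
    ∫⁻ z, ENNReal.ofReal (Real.exp (a * ‖(z i).2‖ ^ 2)) ∂(localGibbsLaw σ a₀ u₀ θ₀ N Φ) ≤ K := by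
  have ha0' : ∀ x, 0 ≤ a₀ x := fun x => (ha0 x).le
  haveI := isProbabilityMeasure_localGibbsMeasure ha hθ hu ha0 hθ0 hσ2 N
  have hg : Measurable fun w : V3 => ENNReal.ofReal (Real.exp (a * ‖w‖ ^ 2)) :=
    (Real.measurable_exp.comp ((measurable_norm.pow_const 2).const_mul a)).ennreal_ofReal
  have hG : Measurable fun z : Config (N + 1) (Fin 3) T3 =>
      ENNReal.ofReal (Real.exp (a * ‖(z i).2‖ ^ 2)) :=
    hg.comp (measurable_pi_apply i).snd
  have hZm : Measurable fun x : Fin (N + 1) → T3 => ENNReal.ofReal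
      ((canonicalPartition (Torus.geometry (Fin 3)) (hsDiameter σ N) (N + 1)
        (localGibbsProfile a₀ u₀ θ₀))⁻¹ * posWeight a₀ (hsDiameter σ N) (N + 1) x) :=
    ((measurable_posWeight ha _ _).const_mul _).ennreal_ofReal
  have hB : ∀ x : Fin (N + 1) → T3,
      ∫⁻ v, ENNReal.ofReal (Real.exp (a * ‖(zipConfig (x, v) i).2‖ ^ 2)) ∂velMeasure u₀ θ₀ x
        ≤ K := by
    intro x
    simp only [zipConfig_apply]
    have hmp : MeasurePreserving (Function.eval i) (velMeasure u₀ θ₀ x)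
        (gaussMeasure (u₀ (x i)) (θ₀ (x i))) := by
      unfold velMeasure
      exact measurePreserving_eval _ i
    calc ∫⁻ v, ENNReal.ofReal (Real.exp (a * ‖v i‖ ^ 2)) ∂velMeasure u₀ θ₀ x
        = ∫⁻ w, ENNReal.ofReal (Real.exp (a * ‖w‖ ^ 2)) ∂gaussMeasure (u₀ (x i)) (θ₀ (x i)) :=
          hmp.lintegral_comp hg
      _ ≤ K := hK (x i)
  rw [localGibbsLaw_eq, lintegral_localGibbsMeasure ha hθ hu ha0' hθ0 σ N hG]
  refine (lintegral_mono fun x => mul_le_mul_right (hB x) _).trans_eq ?_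
  rw [lintegral_mul_const _ hZm, lintegral_posWeight_eq_one ha hθ hu ha0' hθ0 σ N, one_mul]

/-! ## The registered sub-goal -/

/-- **`TailsLambda` at `s = t = 0`: Gaussian velocity moments of the local Gibbs laws, uniformly
in `N`.**  For continuous profiles `a₀, θ₀ > 0`, `u₀` and `σ ≤ 1/2` there are `a > 0` and
`C < ∞` such that `∫ (N+1)⁻¹ ∑ᵢ exp(a ‖vᵢ‖²) dλ_N ≤ C` for every `N` and every hard-sphere flow
`Φ` (`λ_N = localGibbsLaw σ a₀ u₀ θ₀ N Φ` does not depend on `Φ`): Fernique's theorem for the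
standard Gaussian on `ℝ³`, the affine transfer with `a = c/(2 max θ₀)`, the disintegration of the
local Gibbs law into positions and independent Gaussian velocities, and the average over the
particles.  Registered sub-goal of `stub_tailsLambda` (line `Sketch` of crux `LambertianEuler`).
[folklore] -/
theorem localGibbs_expVelocityMoment_le :
    ∀ {a₀ θ₀ : T3 → ℝ} {u₀ : T3 → V3}, Continuous a₀ → Continuous θ₀ → Continuous u₀ →
      (∀ x, 0 < a₀ x) → (∀ x, 0 < θ₀ x) → ∀ {σ : ℝ}, σ ≤ 1 / 2 →
      ∃ a : ℝ, 0 < a ∧ ∃ C : ℝ≥0∞, C < ∞ ∧ ∀ (N : ℕ)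
        (Φ : HardSphereFlow (Torus.geometry (Fin 3)) (hsDiameter σ N) (N + 1)),
        ∫⁻ z, Literature.Barriers.AtomisticToContinuum.expVelocityMoment a z
          ∂(localGibbsLaw σ a₀ u₀ θ₀ N Φ) ≤ C := by
  intro a₀ θ₀ u₀ ha hθ hu ha0 hθ0 σ hσ
  obtain ⟨a, ha_pos, K, hK⟩ := tailsZero_exists_lintegral_exp_gaussMeasure_le hθ hu hθ0
  refine ⟨a, ha_pos, ENNReal.ofReal K, ENNReal.ofReal_lt_top, fun N Φ => ?_⟩
  have hn0 : ((N + 1 : ℕ) : ℝ≥0∞) ≠ 0 := by exact_mod_cast Nat.succ_ne_zero N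
  have hnt : ((N + 1 : ℕ) : ℝ≥0∞) ≠ ∞ := ENNReal.natCast_ne_top _
  have hpt : ∀ z : Config (N + 1) (Fin 3) T3,
      Literature.Barriers.AtomisticToContinuum.expVelocityMoment a z =
        ((N + 1 : ℕ) : ℝ≥0∞)⁻¹ * ∑ i, ENNReal.ofReal (Real.exp (a * ‖(z i).2‖ ^ 2)) := by
    intro z
    rw [Literature.Barriers.AtomisticToContinuum.expVelocityMoment_eq,
      ENNReal.ofReal_mul (inv_nonneg.2 (Nat.cast_nonneg _)),
      ENNReal.ofReal_inv_of_pos (by exact_mod_cast Nat.succ_pos N), ENNReal.ofReal_natCast,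
      ENNReal.ofReal_sum_of_nonneg fun i _ => (Real.exp_pos _).le]
  have hmi : ∀ i : Fin (N + 1), Measurable fun z : Config (N + 1) (Fin 3) T3 =>
      ENNReal.ofReal (Real.exp (a * ‖(z i).2‖ ^ 2)) := fun i =>
    (Real.measurable_exp.comp ((measurable_norm.pow_const 2).const_mul a)).ennreal_ofReal.comp
      (measurable_pi_apply i).snd
  simp_rw [hpt]
  rw [lintegral_const_mul _ (Finset.measurable_sum _ fun i _ => hmi i),
    lintegral_finsetSum _ fun i _ => hmi i]
  calc ((N + 1 : ℕ) : ℝ≥0∞)⁻¹ * ∑ i, ∫⁻ z, ENNReal.ofReal (Real.exp (a * ‖(z i).2‖ ^ 2))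
        ∂(localGibbsLaw σ a₀ u₀ θ₀ N Φ)
      ≤ ((N + 1 : ℕ) : ℝ≥0∞)⁻¹ * ∑ _i : Fin (N + 1), ENNReal.ofReal K := by
        gcongr with i
        exact tailsZero_lintegral_exp_localGibbsLaw_le ha hθ hu ha0 hθ0 hK hσ N Φ i
    _ = ENNReal.ofReal K := by
        rw [Finset.sum_const, Finset.card_univ, Fintype.card_fin, nsmul_eq_mul, ← mul_assoc,
          ENNReal.inv_mul_cancel hn0 hnt, one_mul]

end Summit.AtomisticToContinuum.HydrodynamicLimit.Theorems.LambertianContactSwapLambertianEulerTailsZero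

end
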